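import Summits.AtomisticToContinuum.HydrodynamicLimit.Theses.OneFlightGossipEngine

/-!
# Sketch — crux `KineticCurrentsLDAlongFamilies` (stmt-AtomisticToContinuum-16659), ideator 2, round 1

First lemmas and transfer targets of the two crux-idea cards

* `skolem-only-in-beta`  (nets + Hölder change of reference + energy conservation: every
  uniformity of the family crux except the tilt threshold `β₀` is soft; `β₀` is provably NOT soft —
  explicit jointly convex model `modelΛ`; transfer `KCWUSharp ∧ WindowRenyiFamily ⟹ crux`);
* `identity-theorem-uniformiser` (a data-uniform zero-free complex tilt strip makes the window
  pressures a normal family; the identity theorem propagates the pointwise vanishing on the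
  `s`-dependent real segment to the uniform strip: `ZeroFreeTiltStrip ∧ KCWUEventually ∧
  WindowRenyiFamily ⟹ crux`);
* `peano-reindexing` (the torus is a universal compact index: `CompactFamilyReindexing`, so the
  REGISTERED `𝕋³`-indexed equilibrium core of 14662's sigma-uniform line serves the family crux verbatim).

Everything here is a `def … : Prop` (statements, not proofs) plus the explicit model function.
-/

noncomputable section

namespace Summit.AtomisticToContinuum.HydrodynamicLimit.Cruxes.KineticCurrentsLDAlongFamilies.IdeatorTwoSketch

open MeasureTheory Set Filter
open scoped ENNReal Topology
open Literature.Analysis.FluidPDE (HardSphereFlow Config localMaxwellian canonicalDensity liouville)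
open Literature.MathematicalPhysics.KineticTheory (T3 V3 hsDiameter localGibbsLaw localGibbsProfile)
open Summit.AtomisticToContinuum.HydrodynamicLimit.Theses.OneFlightGossipEngine
  (KineticCurrentsLDAlongFamilies KineticCurrentsWindowLDUniform)

/-! ## Shared vocabulary -/

/-- The hard-sphere flows of the crux at reduced diameter `σ`. -/
abbrev Flow (σ : ℝ) (N : ℕ) :=
  HardSphereFlow (Literature.Analysis.FluidPDE.Torus.geometry (Fin 3)) (hsDiameter σ N) (N + 1)

/-- The crux's class functional `F(x,v) = A(x):w⊗w + (b(x)·w) G(x,|w|²)`, `w = v − u₀(x)`. -/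
def classFun (u₀ : T3 → V3) (A : T3 → Fin 3 → Fin 3 → ℝ) (b : T3 → V3) (G : T3 × ℝ → ℝ)
    (y : T3 × V3) : ℝ :=
  (∑ j : Fin 3, ∑ k : Fin 3, A y.1 j k * ((y.2 - u₀ y.1) j * (y.2 - u₀ y.1) k)) +
    (∑ j : Fin 3, b y.1 j * (y.2 - u₀ y.1) j) * G (y.1, ‖y.2 - u₀ y.1‖ ^ 2)

/-- The kinetic window `w_N = τ (N+1)^{-1/3}`. -/
def window (τ : ℝ) (N : ℕ) : ℝ := τ * ((N : ℝ) + 1) ^ (-(1 / 3 : ℝ))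

/-- The window sum `Σ_i w_N⁻¹ ∫₀^{w_N} F(z_i(r)) dr` (the exponent of the crux, without `β`). -/
def windowSum {σ : ℝ} {N : ℕ} (Φ : Flow σ N) (τ : ℝ) (F : T3 × V3 → ℝ)
    (z : Config (N + 1) (Fin 3) T3) : ℝ :=
  ∑ i : Fin (N + 1), (window τ N)⁻¹ * ∫ r in (0 : ℝ)..(window τ N), F ((Φ.flow r z) i)

/-- The three orthogonality clauses of the class at a macroscopic point (under `M_{1,u,θ}`). -/
def OrthAt (F : T3 × V3 → ℝ) (θ₀ : T3 → ℝ) (u₀ : T3 → V3) (x : T3) : Prop :=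
  (∫ v, F (x, v) * localMaxwellian 1 (θ₀ x) (u₀ x) v = 0) ∧
  (∀ j : Fin 3, ∫ v, F (x, v) * v j * localMaxwellian 1 (θ₀ x) (u₀ x) v = 0) ∧
  (∫ v, F (x, v) * ‖v‖ ^ 2 * localMaxwellian 1 (θ₀ x) (u₀ x) v = 0)

/-! ## Card `skolem-only-in-beta` -/

/-- **`KCWUSharp` — the pointwise docking rung (stmt-14662) with a NUMERIC tilt threshold.**
`β₀` depends only on the bounds `(Θ, U, C)` of the data (temperature range `[Θ⁻¹, Θ]`, drift bound
`U`, class growth `C`) and on `σ`, NOT on the profiles, the weights or the flow; the window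
quantifier is the eventual one `∃ τ₀ ∀ τ ≥ τ₀`; the thresholds `τ₀, N₀` remain pointwise (they may
depend on everything). This is what both registered lines of 14662 output if they close
(`local-gibbs-entropy-ledger`: `β₀ = 1/K_F`, a static Gaussian constant of the data bounds;
`sigma-uniform-equilibrium-transfer`: `β₀ = β₀^{core}(2C(1+U²))/(54q)`), and it is the exact
antecedent from which the FAMILY crux follows softly (`TransferByNets`). -/
def KCWUSharp : Prop :=
  ∃ η₀ : ℝ, 0 < η₀ ∧ ∀ (Θ U C : ℝ), 1 ≤ Θ → 0 ≤ U → 0 ≤ C → ∀ σ : ℝ, 0 < σ →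
  ∃ β₀ : ℝ, 0 < β₀ ∧
  ∀ (a θ₀ : T3 → ℝ) (u₀ : T3 → V3), Continuous a → Continuous θ₀ → Continuous u₀ →
  (∀ x, 0 < a x) → (∀ x, Θ⁻¹ ≤ θ₀ x ∧ θ₀ x ≤ Θ) → (∀ x, ‖u₀ x‖ ≤ U) →
  σ ^ 3 * (⨆ x, a x) ≤ η₀ * ∫ x, a x →
  ∀ Φ : (N : ℕ) → Flow σ N,
  ∀ (A : T3 → Fin 3 → Fin 3 → ℝ) (b : T3 → V3) (G : T3 × ℝ → ℝ),
  Continuous A → Continuous b → Continuous G →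
  (∀ y, |classFun u₀ A b G y| ≤ C * (1 + ‖y.2‖ ^ 2)) →
  (∀ x, OrthAt (classFun u₀ A b G) θ₀ u₀ x) →
  ∀ β : ℝ, |β| ≤ β₀ → ∀ ε : ℝ, 0 < ε → ∃ τ₀ : ℝ, 0 < τ₀ ∧ ∀ τ : ℝ, τ₀ ≤ τ →
  ∃ N₀ : ℕ, ∀ N : ℕ, N₀ ≤ N →
    ∫⁻ z, ENNReal.ofReal (Real.exp (β * windowSum (Φ N) τ (classFun u₀ A b G) z))
        ∂(localGibbsLaw σ a u₀ θ₀ N (Φ N)) ≤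
      ENNReal.ofReal (Real.exp (ε * ((N : ℝ) + 1)))

/-- **`WindowRenyiFamily` — Rényi quasi-invariance of the local Gibbs law over a kinetic window,
UNIFORM ALONG A JOINTLY CONTINUOUS PROFILE FAMILY** (the registered shared stub `stub_windowRenyi`
of 14662's lines `Sketch`/`sigma-uniform-equilibrium-transfer`, re-indexed by `s ∈ [0,t₁]` with
`N₀` uniform in `s`; decay-free; isothermal/constant cases proved in the tree, general case open:
"no LD-cheap energy/momentum courier across `∇θ, ∇u` within a kinetic window"; necessarily
`p < R/(R−1)`, `R = sup θ/inf θ` over the family, 14662 Disproof §7). It is the only dynamical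
input of the net transfer besides `KCWUSharp`: it transports static Gaussian tail bounds across the
window (Jensen in time) and upgrades nothing else. -/
def WindowRenyiFamily : Prop :=
  ∀ (t₁ : ℝ) (a θ₀ : ℝ → T3 → ℝ) (u₀ : ℝ → T3 → V3),
  Continuous (Function.uncurry a) → Continuous (Function.uncurry θ₀) →
  Continuous (Function.uncurry u₀) → (∀ s x, 0 < a s x) → (∀ s x, 0 < θ₀ s x) →
  ∀ σ : ℝ, 0 < σ → σ ≤ 1 / 2 →
  ∃ p : ℝ, 1 < p ∧ ∀ τ : ℝ, 0 < τ → ∀ δ : ℝ, 0 < δ → ∀ Φ : (N : ℕ) → Flow σ N,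
  ∃ N₀ : ℕ, ∀ N : ℕ, N₀ ≤ N → ∀ s ∈ Icc 0 t₁, ∀ r ∈ Icc (0 : ℝ) (window τ N),
    ∫⁻ z, ENNReal.ofReal (canonicalDensity (Literature.Analysis.FluidPDE.Torus.geometry (Fin 3))
          (hsDiameter σ N) (N + 1) (localGibbsProfile (a s) (u₀ s) (θ₀ s)) ((Φ N).flow (-r) z)) ^ p *
        ENNReal.ofReal (canonicalDensity (Literature.Analysis.FluidPDE.Torus.geometry (Fin 3))
          (hsDiameter σ N) (N + 1) (localGibbsProfile (a s) (u₀ s) (θ₀ s)) z) ^ (1 - p)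
      ∂(liouville (Literature.Analysis.FluidPDE.Torus.geometry (Fin 3)) (N + 1) (hsDiameter σ N)) ≤
    ENNReal.ofReal (Real.exp (p * (δ * ((N : ℝ) + 1))))

/-- **Transfer claim of card `skolem-only-in-beta`** (paper proof; provable-now-grade modulo the
static Rényi/Hellinger comparison of two local Gibbs laws and the landed truncation/Jensen tools of
14662's lines): finite nets in `s`, Hölder change of reference law (one-body Rényi cost, static),
Hölder in the functional with PATHWISE kinetic-energy conservation, Gaussian tails moved across the
window by `WindowRenyiFamily`; `β₀ := ½ β₀^{sharp}(Θ,U,C,σ)` with `(Θ,U,C)` the bounds of the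
family on the compact `[0,t₁] × 𝕋³`. -/
def TransferByNets : Prop :=
  KCWUSharp → WindowRenyiFamily → KineticCurrentsLDAlongFamilies

/-- **The explicit no-go model.** `Λ(s,W) = max(s², (|W| − 1 + √((1−|W|)² + 4s²))/2)`: a model
"asymptotic window pressure" (`s` = profile parameter, `W` = tilt × weight amplitude). -/
def modelΛ (s W : ℝ) : ℝ :=
  max (s ^ 2) ((|W| - 1 + Real.sqrt ((1 - |W|) ^ 2 + 4 * s ^ 2)) / 2)

/-- **`NoSoftUniformityModel` — the tilt threshold is NOT a soft quantity (first lemma of card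
`skolem-only-in-beta`; pure Mathlib, provable now).** The explicit function `modelΛ` has EVERY
structural property the soft/"open-condition" arguments use — joint convexity in (parameter,
tilted weight), continuity, Lipschitz dependence on the parameter (stronger than the Hölder/Rényi
change-of-reference estimate), non-negativity of the pressure above its value at zero tilt, and a
positive flat (zero-pressure) radius at EVERY parameter — and yet its flat radius is `1` at `s = 0`
and `s²` at `s ≠ 0`: no uniform radius on the compact family `[0,1]`. Hence no argument using only
these properties can lift the pointwise rung 14662 to the family crux 16659; the uniform `β₀` must
come from a formula (numeric dependence on data bounds, `KCWUSharp`) or from analyticity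
(card `identity-theorem-uniformiser`). -/
def NoSoftUniformityModel : Prop :=
  ConvexOn ℝ Set.univ (Function.uncurry modelΛ) ∧
  Continuous (Function.uncurry modelΛ) ∧
  (∀ s W : ℝ, modelΛ s 0 ≤ modelΛ s W) ∧
  (∀ s : ℝ, modelΛ s 0 = s ^ 2) ∧
  (∀ s ∈ Icc (0 : ℝ) 1, ∀ s' ∈ Icc (0 : ℝ) 1, ∀ W : ℝ, |modelΛ s W - modelΛ s' W| ≤ 2 * |s - s'|) ∧
  (∀ s : ℝ, ∃ r : ℝ, 0 < r ∧ ∀ W : ℝ, |W| ≤ r → modelΛ s W = modelΛ s 0) ∧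
  (∀ r : ℝ, 0 < r → ∃ s ∈ Icc (0 : ℝ) 1, ∃ W : ℝ, |W| ≤ r ∧ modelΛ s 0 < modelΛ s W)

/-- Sanity: the value at zero tilt (one conjunct of `NoSoftUniformityModel`, proved). -/
theorem modelΛ_zero (s : ℝ) : modelΛ s 0 = s ^ 2 := by
  unfold modelΛ
  have h1 : Real.sqrt ((1 - |(0:ℝ)|) ^ 2 + 4 * s ^ 2) = Real.sqrt (1 + 4 * s ^ 2) := by
    simp
  rw [h1]
  apply max_eq_left
  have hs : Real.sqrt (1 + 4 * s ^ 2) ≤ 1 + 2 * s ^ 2 := by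
    rw [Real.sqrt_le_left (by positivity)]
    nlinarith [sq_nonneg s]
  simp only [abs_zero]
  linarith

/-- Sanity: off the flat set the model pressure is positive — at parameter `s ≠ 0` the flat radius
is at most `s²` (the tilt `W = 2 s²` already has positive pressure), although at `s = 0` it is `1`.
(Numerical instance of the last conjunct; the general conjuncts are routine real analysis.) -/
theorem modelΛ_pos_example : modelΛ (1/2) 0 < modelΛ (1/2) (1/2) := by
  rw [modelΛ_zero]
  unfold modelΛ
  apply lt_max_of_lt_right
  have h : (1:ℝ) < Real.sqrt ((1 - |(1/2:ℝ)|) ^ 2 + 4 * (1/2:ℝ) ^ 2) := by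
    rw [show |(1/2:ℝ)| = 1/2 by norm_num]
    rw [Real.lt_sqrt (by norm_num)]
    norm_num
  rw [show |(1/2:ℝ)| = 1/2 by norm_num] at *
  linarith

/-! ## Card `identity-theorem-uniformiser` -/

/-- **`KCWUEventually` — the pointwise rung 14662 with the eventual window quantifier**
(`∃ τ` replaced by `∃ τ₀ ∀ τ ≥ τ₀`; `β₀` still pointwise, i.e. allowed to depend on the profiles,
the flow and the weights — the Skolem form). It follows from 14662 by window monotonicity under the
local law (Hölder over sub-windows + `stub_windowRenyi`), and it is what the equilibrium core of the
sigma-uniform line is typed with. -/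
def KCWUEventually : Prop :=
  ∃ η₀ : ℝ, 0 < η₀ ∧ ∀ (a θ₀ : T3 → ℝ) (u₀ : T3 → V3), Continuous a → Continuous θ₀ →
  Continuous u₀ → (∀ x, 0 < a x) → (∀ x, 0 < θ₀ x) → ∀ σ : ℝ, 0 < σ →
  σ ^ 3 * (⨆ x, a x) ≤ η₀ * ∫ x, a x → ∀ Φ : (N : ℕ) → Flow σ N,
  ∀ (A : T3 → Fin 3 → Fin 3 → ℝ) (b : T3 → V3) (G : T3 × ℝ → ℝ),
  Continuous A → Continuous b → Continuous G →
  (∃ C : ℝ, ∀ y, |classFun u₀ A b G y| ≤ C * (1 + ‖y.2‖ ^ 2)) →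
  (∀ x, OrthAt (classFun u₀ A b G) θ₀ u₀ x) →
  ∃ β₀ : ℝ, 0 < β₀ ∧ ∀ β : ℝ, |β| ≤ β₀ → ∀ ε : ℝ, 0 < ε → ∃ τ₀ : ℝ, 0 < τ₀ ∧ ∀ τ : ℝ, τ₀ ≤ τ →
  ∃ N₀ : ℕ, ∀ N : ℕ, N₀ ≤ N →
    ∫⁻ z, ENNReal.ofReal (Real.exp (β * windowSum (Φ N) τ (classFun u₀ A b G) z))
        ∂(localGibbsLaw σ a u₀ θ₀ N (Φ N)) ≤
      ENNReal.ofReal (Real.exp (ε * ((N : ℝ) + 1)))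

/-- The complexified window partition function `Z_N(β) = ∫ exp(β · windowSum) dλ`, `β ∈ ℂ`. -/
def complexWindowZ {σ : ℝ} {N : ℕ} (Φ : Flow σ N) (lam : Measure (Config (N + 1) (Fin 3) T3))
    (τ : ℝ) (F : T3 × V3 → ℝ) (β : ℂ) : ℂ :=
  ∫ z, Complex.exp (β * (windowSum Φ τ F z : ℂ)) ∂lam

/-- **`ZeroFreeTiltStrip` — a data-uniform zero-free complex tilt disc with a volume-order lower
bound.** There is a packing guard `η₀` such that for data bounds `(Θ, U, C)` and `σ` there are
NUMERIC `β₁ > 0`, `c ≥ 0` such that along every jointly continuous family of profiles/weights within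
the bounds (packing guard at every `s`, class growth `C`, orthogonality at every `(s,x)`), every flow family and every window parameter `τ`, for all large `N`
and all `s ∈ [0,t₁]`: `|Z_N(β; s)| ≥ e^{−c(N+1)}` for all complex `|β| ≤ β₁`. TRUE for the free gas
(`σ = 0`: `Z_N` is a product of one-body Gaussian integrals, zero-free near `0`) — so it carries NONE
of the crux's decay content (14662 Disproof §1's witness does not touch it); it is a "no dynamical
phase transition at infinite tilt-temperature" / uniform-analyticity statement, the output shape of
any convergent space-time cluster or cumulant expansion at small COMPLEX tilt. -/
def ZeroFreeTiltStrip : Prop :=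
  ∃ η₀ : ℝ, 0 < η₀ ∧ ∀ (Θ U C : ℝ), 1 ≤ Θ → 0 ≤ U → 0 ≤ C → ∀ σ : ℝ, 0 < σ →
  ∃ β₁ : ℝ, 0 < β₁ ∧ ∃ c : ℝ, 0 ≤ c ∧
  ∀ (t₁ : ℝ) (a θ₀ : ℝ → T3 → ℝ) (u₀ : ℝ → T3 → V3),
  Continuous (Function.uncurry a) → Continuous (Function.uncurry θ₀) →
  Continuous (Function.uncurry u₀) → (∀ s x, 0 < a s x) →
  (∀ s ∈ Icc 0 t₁, ∀ x, Θ⁻¹ ≤ θ₀ s x ∧ θ₀ s x ≤ Θ) → (∀ s ∈ Icc 0 t₁, ∀ x, ‖u₀ s x‖ ≤ U) →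
  (∀ s ∈ Icc 0 t₁, σ ^ 3 * (⨆ x, a s x) ≤ η₀ * ∫ x, a s x) →
  ∀ Φ : (N : ℕ) → Flow σ N,
  ∀ (A : ℝ → T3 → Fin 3 → Fin 3 → ℝ) (b : ℝ → T3 → V3) (G : ℝ → T3 × ℝ → ℝ),
  Continuous (Function.uncurry A) → Continuous (Function.uncurry b) →
  Continuous (Function.uncurry G) →
  (∀ s ∈ Icc 0 t₁, ∀ y, |classFun (u₀ s) (A s) (b s) (G s) y| ≤ C * (1 + ‖y.2‖ ^ 2)) →
  (∀ s ∈ Icc 0 t₁, ∀ x, OrthAt (classFun (u₀ s) (A s) (b s) (G s)) (θ₀ s) (u₀ s) x) →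
  ∀ τ : ℝ, 0 < τ → ∃ N₀ : ℕ, ∀ N : ℕ, N₀ ≤ N → ∀ s ∈ Icc 0 t₁, ∀ β : ℂ, ‖β‖ ≤ β₁ →
    Real.exp (-(c * ((N : ℝ) + 1))) ≤
      ‖complexWindowZ (Φ N) (localGibbsLaw σ (a s) (u₀ s) (θ₀ s) N (Φ N)) τ
          (classFun (u₀ s) (A s) (b s) (G s)) β‖

/-- **`IdentityUniformiser` — the abstract amplification lemma (first lemma of card
`identity-theorem-uniformiser`; pure Mathlib: Montel via Cauchy estimates + Arzelà–Ascoli, and the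
identity theorem).** A uniformly bounded sequence of holomorphic functions on the disc `|β| < b₁`
that tends to `0` at every real point of SOME segment `[−b, b]` (however short) tends to `0` at
every real point of the whole disc. In the application `p_n` are (iterated limits of) the scaled
complex window pressures `(N+1)⁻¹ log Z_N(β; s)` — holomorphic and bounded on the disc by
`ZeroFreeTiltStrip` + the static real bound `|Z_N(β)| ≤ Z_N(Re β)` — and `b = β₀(s)` is the
pointwise (Skolem) threshold of `KCWUEventually`; the output is the `s`-INDEPENDENT threshold
`b₁`. -/
def IdentityUniformiser : Prop :=
  ∀ (b₁ M : ℝ), 0 < b₁ → ∀ p : ℕ → ℂ → ℂ,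
  (∀ n, DifferentiableOn ℂ (p n) (Metric.ball (0 : ℂ) b₁)) →
  (∀ n, ∀ z ∈ Metric.ball (0 : ℂ) b₁, ‖p n z‖ ≤ M) →
  (∃ b : ℝ, 0 < b ∧ ∀ x : ℝ, |x| ≤ b → Tendsto (fun n => p n (x : ℂ)) atTop (𝓝 0)) →
  ∀ x : ℝ, |x| < b₁ → Tendsto (fun n => p n (x : ℂ)) atTop (𝓝 0)

/-- **Transfer claim of card `identity-theorem-uniformiser`** (paper proof): zero-freeness +
static bound ⇒ `(N+1)⁻¹ log Z_N(·; s)` is a normal family on the disc, uniformly in `s`;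
`IdentityUniformiser` (applied along `N → ∞` then `τ → ∞`) turns the pointwise real vanishing on
`[−β₀(s), β₀(s)]` into vanishing on `(−β₁, β₁)` for EVERY `s`; the remaining `(τ₀, N₀)`-uniformity
in `s` is the soft net argument of `TransferByNets` (now legal because the tilt range is uniform). -/
def TransferByAnalyticity : Prop :=
  ZeroFreeTiltStrip → KCWUEventually → WindowRenyiFamily → KineticCurrentsLDAlongFamilies


/-! ## Card `peano-reindexing` -/

/-- **`CompactFamilyReindexing` — the torus is a universal compact index (first lemma of card
`peano-reindexing`; provable now on paper: a Cantor set `C ⊂ 𝕋³` surjects continuously onto the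
compact metrizable `[0,t₁] × 𝕋³` (Hausdorff–Alexandroff), and `D ∘ c : C → K` extends continuously to
`𝕋³ → K` for convex `K ⊆ ℝᵏ` (Dugundji–Tietze; Mathlib `TietzeExtension` + `Pi.instTietzeExtension`
for `K = ℝᵏ`, the convex-valued refinement by Dugundji)).** Every jointly continuous family of
finite-dimensional frozen data on `[0,t₁] × 𝕋³` taking values in a convex set `K` is COVERED by the
range of ONE continuous `K`-valued field on `𝕋³`. Consequence: a statement quantified
`∀ continuous fields on 𝕋³ … ∃ thresholds … ∀ x₀ ∈ 𝕋³` (the registered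
`stub_frozenEquilibriumCore` of 14662's sigma-uniform line) already yields thresholds uniform over
ANY compact family of frozen data — in particular along the family crux's `(s, x) ∈ [0,t₁] × 𝕋³`. -/
def CompactFamilyReindexing : Prop :=
  ∀ (k : ℕ) (K : Set (Fin k → ℝ)), Convex ℝ K → ∀ (t₁ : ℝ) (D : ℝ × T3 → (Fin k → ℝ)),
  Continuous D → (∀ p ∈ Icc (0 : ℝ) t₁ ×ˢ (univ : Set T3), D p ∈ K) →
  ∃ D' : T3 → (Fin k → ℝ), Continuous D' ∧ (∀ y, D' y ∈ K) ∧
    D '' (Icc (0 : ℝ) t₁ ×ˢ (univ : Set T3)) ⊆ range D'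

/-- Sanity (the trivial direction of universality, proved): a field on `𝕋³` is a constant family. -/
theorem reindexing_const_family (k : ℕ) (D' : T3 → (Fin k → ℝ)) (t₁ : ℝ) :
    (fun p : ℝ × T3 => D' p.2) '' (Icc (0 : ℝ) t₁ ×ˢ (univ : Set T3)) ⊆ range D' := by
  rintro _ ⟨p, -, rfl⟩
  exact ⟨p.2, rfl⟩

end Summit.AtomisticToContinuum.HydrodynamicLimit.Cruxes.KineticCurrentsLDAlongFamilies.IdeatorTwoSketch

end
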